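import Summits.ABC.IUTFork.Conditional.AbcOfSSharpLevelCutJunction
import HarnessLib

/-!
# Branch C «abc ⇐ S»: the `j ≠ 1728` clause of the SHARP LEVEL CUT is immaterial for the books — at a point with `j(λ) = 1728` no book
# assumes anything (`Cor22.AdmitsCore` excludes `j = 1728`) (abc-iut cell, branch C, row «C-LEVELCUT-SHARP», remark file; seat abc-iut-C-cert-2 gen 7)

Record-only PROOF file (D-0012; 0 definitions, 0 `Prop` facts, nothing re-typed) of the abc-iut cell. TAKES NO SIDE on [IUTchIII] Cor. 3.12,
on [IUTchIV] Thm. 1.10, or on any author.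

Every binder of every book of record is guarded by `Cor22.AdmitsCore P →` ("the once-punctured elliptic curve admits an `F`-core":
`∀ q ∈ coreExceptionalJ, jInv P.x ≠ q`, with `coreExceptionalJ = {488095744/125, 1556068/81, 1728, 0}`, [IUTchIV] Cor. 2.2 (ii) p. 43). The
sharp eventual theorems (p508140, p512345, p520076, p522868) and the sharp cut junctions (p510580) carry the side condition `j(a/c) ≠ 1728`
(the only abc-triple Frey point with `j = 1728` is `λ = 1/2`, the triple `1 + 1 = 2`). This file records that the exception costs nothing:

* **`SharpCutU.not_admitsCore_of_jInv_eq`** — `jInv P.x = 1728 → ¬ Cor22.AdmitsCore P`;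
* **`SharpCutU.cor312Of_of_not_sharp'`** — the junction of file 1 with the `j ≠ 1728` clause REMOVED from the cut predicate, under the books'
  own guard `Cor22.AdmitsCore P`: off «`∀ a b c, IsABCTriple a b c → P = ratPoint (a/c) → l ≤ 4·Nat.sqrt(abc)+4 ∧ ∃ odd p ∣ abc, l ≤ max p (4·p^{⌊v_p/2⌋})`»
  every genuine `T` has `T.Cor312Of`.

So the census sentence may read «at EVERY abc-triple Frey point» with no `j`-exception. A remark; counts unchanged; typed ≠ proved; no abc claim.
[cite: Mochizuki2012, IUTchIV Cor. 2.2 (ii) p. 43; IUTchIII Cor. 3.12 p. 173–174] [claim: Mochizuki2012, status: disputed] for every IUT sentence.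
-/

noncomputable section

open Set Function NumberField IsDedekindDomain

namespace Summit.ABC.IUTFork.Conditional

open Thm311 Thm311.Real Cor312 Cor312Vol Cor312Prov Literature.IUT.LogThetaLattice Literature.IUT.LogVolume
  Literature.IUT.HodgeTheaters Literature.IUT.LogVolume.ThetaData Literature.IUT.LogVolume.Cor22
open Literature.NumberTheory.NumberFields Literature.NumberTheory.GaloisRepresentations.Ultrametric
open Literature.NumberTheory.DiophantineGeometry Literature.NumberTheory.DiophantineGeometry.GenEll Summit.ABC.ABC.Theorems

/-- **`j(λ) = 1728` ⟹ the curve admits NO core in the sense of [IUTchIV] Cor. 2.2 (ii)** (`1728 ∈ coreExceptionalJ`), so every binder guarded by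
`Cor22.AdmitsCore P` is void at such a point. [cite: Mochizuki2012, IUTchIV Cor. 2.2 (ii) p. 43] [claim: Mochizuki2012, status: disputed] -/
theorem SharpCutU.not_admitsCore_of_jInv_eq {P : NFPoint} (h : Cor22.jInv P.x = 1728) : ¬ Cor22.AdmitsCore P := by
  intro hA
  have h1728 : (1728 : ℚ) ∈ Cor22.coreExceptionalJ := by
    unfold Cor22.coreExceptionalJ; simp
  exact hA 1728 h1728 (by rw [h]; push_cast; rfl)

/-- **The sharp-cut junction WITHOUT the `j ≠ 1728` clause, under the books' guard `AdmitsCore`**: if it is NOT the case that «whenever `P` is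
the Frey point of an abc triple, `l ≤ 4·Nat.sqrt(abc)+4` and some odd bad `p` has `l ≤ max p (4·p^{⌊v_p/2⌋})`», then at every genuine `T` of an
admissible `(P, l)` (`AdmitsCore P`), `T.Cor312Of` — file 1's `SharpCutU.cor312Of_of_not_sharp` when `j ≠ 1728`, vacuous when `j = 1728`.
[cite: Mochizuki2012, IUTchIII Cor. 3.12 p. 173–174; IUTchIV Cor. 2.2 (ii) p. 43] [claim: Mochizuki2012, status: disputed] -/
theorem SharpCutU.cor312Of_of_not_sharp' {P : NFPoint} {l : ℕ} (hl : l.Prime) (h5 : 5 ≤ l)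
    (hs : ¬ ∀ a b c : ℕ, IsABCTriple a b c → P = ratPoint ((a : ℚ) / c) →
      l ≤ 4 * Nat.sqrt (a * b * c) + 4 ∧
        ∃ p : ℕ, p.Prime ∧ p ∣ a * b * c ∧ p ≠ 2 ∧ l ≤ max p (4 * p ^ ((a * b * c).factorization p / 2)))
    (hA : Cor22.AdmitsCore P) (T : Cor22.ThetaVolumeDatumAt P l) : T.Cor312Of := by
  by_cases hj : ∀ a b c : ℕ, IsABCTriple a b c → P = ratPoint ((a : ℚ) / c) → Cor22.jInv ((a : ℚ) / c) ≠ 1728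
  · refine SharpCutU.cor312Of_of_not_sharp hl h5 (fun h => hs fun a b c habc hP => h a b c habc (hj a b c habc hP) hP) T
  · push Not at hj
    obtain ⟨a, b, c, -, rfl, h1728⟩ := hj
    exact absurd hA (SharpCutU.not_admitsCore_of_jInv_eq (P := ratPoint ((a : ℚ) / c)) h1728)

end Summit.ABC.IUTFork.Conditional

end
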